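import Summits.CriticalPhenomena.PercolationContinuityZ3.Theorems.PercNearOneGluingNoHeavyLowerTailSelectionPrinciple
import Summits.CriticalPhenomena.PercolationContinuityZ3.Theorems.PercNearOneGluingNoHeavyLowerTailCILConstReduction
import HarnessLib

/-!
# `NoHeavyLowerTail` (stmt-CriticalPhenomena-4575) — the CONDITIONAL selection principle ("level-`t` Lemma 2"):
# typed socket to the crux (any constant) and calibration against Kozma–Nitzan's Conjecture 1

New-inequality factory #6 (prim-ineq-gen-6 gen 5), 2026-08-19, `--supports stmt-CriticalPhenomena-4575`.  No definitions,
no named facts, no sorries.  Vocabulary of `…SelectionPrinciple.lean` (prim-hp-4): `μ = prodBernoulli w` on `Fin n`; observer `o`;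
candidates `S`; target alphabet `V ⊇ S` with `o ∉ V`; a MONOTONE target `𝒯` on subsets of `V` read on relay patterns,
`𝒯(c) = {ω | 𝒯 (V.filter (c ↔ ·))}`, `t_c = μ(𝒯(c))`; a ranking `ρ` of `S` listing SMALLER `t` first; first-reached events
`E_c = {o ↔ c} ∩ {o ↮ c′ for c′ ranked before c}`.  The CONDITIONAL SELECTION PRINCIPLE with constant `C` — CSP(C) — is the
hypothesis

  `Σ_{c∈S} μ(E_c ∩ ¬𝒯(c)) / μ(¬𝒯(c)) ≤ C · μ(o ↔ S)`,  i.e.  `Σ_c μ(W = c | C(c) ∉ 𝒯) ≤ C · μ(o ↔ S)`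

("the first-reached selection probabilities, CONDITIONED on the selected candidate missing its target, sum to at most
(`C` times) the reach probability").  At `C = 1`: for the block target `𝒯 = (|·| ≥ 2)` and `S = V = A` this is literally
Kozma–Nitzan's Lemma 2 (`Σ_a φ(a) ≤ φ(A) ≤ μ(o ↔ A)`, tree `KozmaNitzan2024_lemma2`); it is a sharpening of prim-hp-4's selection
principle (SP) (`Σ_c Cov(E_c, 𝒯(c)) ≥ 0` becomes `Σ_c Cov(E_c, 𝒯(c))/(1 − t_c) ≥ 0`); it is census-clean (memo FINDING-G5.md: ≈1.2·10⁴
exact (graph, target) instances, 7.5·10⁴ ordered pairs, adversarial climbs; the weights `(1 − t_c)^{-s}` are valid exactly up to `s = 1`).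
HERE: CSP(C) for the block target at the half level ⟹ the cumulative isolation lemma with constant `C` ⟹ `NoHeavyLowerTail`
(`cumulativeIsolation_of_conditionalSelection`, `noHeavyLowerTail_of_conditionalSelection`), and the calibration CSP(1) ⟹
Kozma–Nitzan's Conjecture 1 with the sharp constant (`kozmaNitzan_conjecture1_of_conditionalSelection`).
-/

noncomputable section

namespace Summit.CriticalPhenomena.PercolationContinuityZ3.Theorems

open MeasureTheory Set Literature.Probability.LatticeModels Literature.Probability.Percolation
open scoped Classical BigOperators

namespace ConditionalSelection

variable {n : ℕ}

/-- **CSP(C) ⟹ the cumulative isolation lemma with constant `C` at every level.**  Apply the conditional selection principle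
with `S = V = A` and the monotone target `|T| > j`, ranking relays of LARGER lightness probability `g c = μ(|π(c)| ≤ j)` first;
cover `{1 ≤ N ≤ j}` by the events `E_c ∩ {|π(c)| ≤ j}`; bound each `μ(E_c ∩ light c) ≤ g_max · (μ(E_c ∩ light c)/g c)` and sum.
[this work; bookkeeping adapted from `SelectionOrder.blockLightest_of_selectionPrinciple`] -/
theorem cumulativeIsolation_of_conditionalSelection (C : ℝ) (hC : 0 ≤ C)
    (hCSP : ∀ (n : ℕ) (w : Sym2 (Fin n) → unitInterval) (S V : Finset (Fin n)) (o : Fin n)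
      (𝒯 : Finset (Fin n) → Prop) (ρ : Fin n → ℕ), S ⊆ V → o ∉ V → (∀ T T' : Finset (Fin n), T ⊆ T' → 𝒯 T → 𝒯 T') →
      Set.InjOn ρ ↑S →
      (∀ b ∈ S, ∀ c ∈ S, ρ c < ρ b →
        (prodBernoulli w).real {ω : BondConfig (Fin n) | 𝒯 (V.filter fun x => ω ∈ openConn c x)} ≤
          (prodBernoulli w).real {ω : BondConfig (Fin n) | 𝒯 (V.filter fun x => ω ∈ openConn b x)}) →
      ∑ c ∈ S, (prodBernoulli w).real
          ((openConn o c ∩ {ω : BondConfig (Fin n) | ∀ c' ∈ S, ρ c' < ρ c → ω ∉ openConn o c'}) ∩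
            {ω : BondConfig (Fin n) | ¬ 𝒯 (V.filter fun x => ω ∈ openConn c x)}) /
        (prodBernoulli w).real {ω : BondConfig (Fin n) | ¬ 𝒯 (V.filter fun x => ω ∈ openConn c x)} ≤
      C * (prodBernoulli w).real (⋃ c ∈ S, (openConn o c : Set (BondConfig (Fin n))))) :
    ∀ (n : ℕ) (w : Sym2 (Fin n) → unitInterval) (A : Finset (Fin n)) (o : Fin n) (j : ℕ),
      A.Nonempty → o ∉ A → ∃ a ∈ A,
        (prodBernoulli w).real {ω : BondConfig (Fin n) |
            1 ≤ (A.filter fun x => ω ∈ openConn o x).card ∧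
              (A.filter fun x => ω ∈ openConn o x).card ≤ j} ≤
          C * (prodBernoulli w).real {ω : BondConfig (Fin n) |
            (A.filter fun x => ω ∈ openConn a x).card ≤ j} := by
  intro n w A o j hA ho
  set μ := prodBernoulli w with hμ
  set light : Fin n → Set (BondConfig (Fin n)) := fun c =>
    {ω | (A.filter fun x => ω ∈ openConn c x).card ≤ j} with hlight
  set heavy : Fin n → Set (BondConfig (Fin n)) := fun c =>
    {ω | j < (A.filter fun x => ω ∈ openConn c x).card} with hheavy
  set g : Fin n → ℝ := fun c => μ.real (light c) with hg
  -- rank by decreasing lightness probability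
  obtain ⟨ρ, hρ, hmono⟩ := CoinReduction.exists_compatible_ranking g A
  set E : Fin n → Set (BondConfig (Fin n)) := fun c =>
    openConn o c ∩ {ω : BondConfig (Fin n) | ∀ c' ∈ A, ρ c' < ρ c → ω ∉ openConn o c'} with hE
  have hcompl : ∀ c, heavy c = (light c)ᶜ := by
    intro c; ext ω; simp [hheavy, hlight, not_le]
  have hnot : ∀ c, {ω : BondConfig (Fin n) | ¬ j < (A.filter fun x => ω ∈ openConn c x).card} = light c := by
    intro c; ext ω; simp [hlight, not_lt]
  have hheavy_real : ∀ c, μ.real (heavy c) = 1 - g c := by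
    intro c; rw [hcompl c]; exact probReal_compl_eq_one_sub MeasurableSet.of_discrete
  -- the conditional selection principle for the heavy target, complement read as `light`
  have hCSPA := hCSP n w A A o (fun T => j < T.card) ρ (subset_refl A) ho
    (fun T T' hTT' hT => lt_of_lt_of_le hT (Finset.card_le_card hTT')) hρ
    (by
      intro b hb c hc hlt
      have h1 : g b ≤ g c := hmono c hc b hb hlt
      have hb' := hheavy_real b
      have hc' := hheavy_real c
      simp only [hheavy] at hb' hc'
      linarith)
  simp only [hnot] at hCSPA
  change ∑ c ∈ A, μ.real (E c ∩ light c) / g c ≤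
    C * μ.real (⋃ c ∈ A, (openConn o c : Set (BondConfig (Fin n)))) at hCSPA
  -- (1) cover: `{1 ≤ N ≤ j} ⊆ ⋃_c (E_c ∩ light c)`
  have hcover : {ω : BondConfig (Fin n) |
        1 ≤ (A.filter fun x => ω ∈ openConn o x).card ∧ (A.filter fun x => ω ∈ openConn o x).card ≤ j} ⊆
      ⋃ c ∈ A, (E c ∩ light c) := by
    intro ω hω
    obtain ⟨h1, h2⟩ := hω
    obtain ⟨b, hb, hbmin⟩ := Finset.exists_min_image (A.filter fun x => ω ∈ openConn o x) ρ (Finset.card_pos.1 h1)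
    obtain ⟨hbA, hob⟩ := Finset.mem_filter.1 hb
    refine mem_iUnion₂.2 ⟨b, hbA, ⟨hob, fun c' hc' hlt hoc' => ?_⟩, ?_⟩
    · have := hbmin c' (Finset.mem_filter.2 ⟨hc', hoc'⟩)
      omega
    · have heq : (A.filter fun x => ω ∈ openConn b x) = (A.filter fun x => ω ∈ openConn o x) := by
        apply Finset.filter_congr
        intro x _
        exact ⟨fun hbx => (hob : (openGraph ω).Reachable o b).trans hbx,
          fun hox => (hob : (openGraph ω).Reachable o b).symm.trans hox⟩
      simp only [hlight, mem_setOf_eq, heq]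
      exact h2
  have hstep1 : μ.real {ω : BondConfig (Fin n) |
        1 ≤ (A.filter fun x => ω ∈ openConn o x).card ∧ (A.filter fun x => ω ∈ openConn o x).card ≤ j} ≤
      ∑ c ∈ A, μ.real (E c ∩ light c) :=
    (measureReal_mono hcover (measure_ne_top μ _)).trans (measureReal_biUnion_finset_le _ _)
  -- (2) the most detached relay `a` (largest lightness probability)
  obtain ⟨a, ha, hamax⟩ := Finset.exists_max_image A g hA
  have hga : 0 ≤ g a := measureReal_nonneg
  -- (3) termwise: `μ(E_c ∩ light c) ≤ g a · (μ(E_c ∩ light c) / g c)`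
  have hterm : ∀ c ∈ A, μ.real (E c ∩ light c) ≤ g a * (μ.real (E c ∩ light c) / g c) := by
    intro c hc
    have hle : μ.real (E c ∩ light c) ≤ g c := measureReal_mono inter_subset_right
    have hnn : 0 ≤ μ.real (E c ∩ light c) := measureReal_nonneg
    by_cases hgc : g c = 0
    · rw [hgc, div_zero, mul_zero]
      linarith
    · have hgpos : 0 < g c := lt_of_le_of_ne measureReal_nonneg (Ne.symm hgc)
      calc μ.real (E c ∩ light c) = g c * (μ.real (E c ∩ light c) / g c) := by field_simp
        _ ≤ g a * (μ.real (E c ∩ light c) / g c) :=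
          mul_le_mul_of_nonneg_right (hamax c hc) (div_nonneg hnn hgpos.le)
  have hstep2 : ∑ c ∈ A, μ.real (E c ∩ light c) ≤ g a * ∑ c ∈ A, μ.real (E c ∩ light c) / g c := by
    rw [Finset.mul_sum]
    exact Finset.sum_le_sum hterm
  have hU1 : μ.real (⋃ c ∈ A, (openConn o c : Set (BondConfig (Fin n)))) ≤ 1 := measureReal_le_one
  have hstep3 : g a * ∑ c ∈ A, μ.real (E c ∩ light c) / g c ≤ C * g a := by
    calc g a * ∑ c ∈ A, μ.real (E c ∩ light c) / g c
        ≤ g a * (C * μ.real (⋃ c ∈ A, (openConn o c : Set (BondConfig (Fin n))))) :=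
          mul_le_mul_of_nonneg_left hCSPA hga
      _ ≤ g a * (C * 1) := mul_le_mul_of_nonneg_left (mul_le_mul_of_nonneg_left hU1 hC) hga
      _ = C * g a := by ring
  refine ⟨a, ha, ?_⟩
  calc μ.real {ω : BondConfig (Fin n) |
          1 ≤ (A.filter fun x => ω ∈ openConn o x).card ∧ (A.filter fun x => ω ∈ openConn o x).card ≤ j}
      ≤ ∑ c ∈ A, μ.real (E c ∩ light c) := hstep1
    _ ≤ g a * ∑ c ∈ A, μ.real (E c ∩ light c) / g c := hstep2
    _ ≤ C * g a := hstep3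
    _ = C * μ.real (light a) := rfl

/-- **CSP(C) ⟹ `NoHeavyLowerTail`**: the conditional selection principle with ANY constant `C ≥ 0` closes the crux, through
the all-levels cumulative isolation lemma with constant `C` (`noHeavyLowerTail_of_cumulativeIsolationConst_allLevels`).
Only the instance `S = V = A`, target `|·| > ⌊|A|/2⌋` of the hypothesis is used. [this work] -/
theorem noHeavyLowerTail_of_conditionalSelection (C : ℝ) (hC : 0 ≤ C)
    (hCSP : ∀ (n : ℕ) (w : Sym2 (Fin n) → unitInterval) (S V : Finset (Fin n)) (o : Fin n)
      (𝒯 : Finset (Fin n) → Prop) (ρ : Fin n → ℕ), S ⊆ V → o ∉ V → (∀ T T' : Finset (Fin n), T ⊆ T' → 𝒯 T → 𝒯 T') →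
      Set.InjOn ρ ↑S →
      (∀ b ∈ S, ∀ c ∈ S, ρ c < ρ b →
        (prodBernoulli w).real {ω : BondConfig (Fin n) | 𝒯 (V.filter fun x => ω ∈ openConn c x)} ≤
          (prodBernoulli w).real {ω : BondConfig (Fin n) | 𝒯 (V.filter fun x => ω ∈ openConn b x)}) →
      ∑ c ∈ S, (prodBernoulli w).real
          ((openConn o c ∩ {ω : BondConfig (Fin n) | ∀ c' ∈ S, ρ c' < ρ c → ω ∉ openConn o c'}) ∩
            {ω : BondConfig (Fin n) | ¬ 𝒯 (V.filter fun x => ω ∈ openConn c x)}) /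
        (prodBernoulli w).real {ω : BondConfig (Fin n) | ¬ 𝒯 (V.filter fun x => ω ∈ openConn c x)} ≤
      C * (prodBernoulli w).real (⋃ c ∈ S, (openConn o c : Set (BondConfig (Fin n))))) :
    Summit.CriticalPhenomena.PercolationContinuityZ3.Theses.PercNearOneGluing.NoHeavyLowerTail :=
  noHeavyLowerTail_of_cumulativeIsolationConst_allLevels C hC
    (cumulativeIsolation_of_conditionalSelection C hC hCSP)

/-- **Calibration: CSP(1) ⟹ Kozma–Nitzan's Conjecture 1** with the sharp constant (`μ(o ↔ A)·t ≤ μ(o ↔ b)` whenever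
`t ≤ μ(a ↔ b)` for all `a ∈ A`): apply the principle with `S = A`, `V = A ∪ {b}`, the monotone target `b ∈ T`, ranking LESS
reliable relays first; then `μ(o ↔ A, o ↮ b) = Σ_c μ(E_c ∩ {c ↮ b}) ≤ (1 − t)·Σ_c μ(E_c ∩ {c ↮ b})/μ(c ↮ b) ≤ (1 − t)·μ(o ↔ A)`.
So CSP(1) sits above KN's open Conjecture 1, as the unconditional principle (SP) does.
[cite: KozmaNitzan2024, Conjecture 1 (p. 3), Lemma 2 (p. 6)] -/
theorem kozmaNitzan_conjecture1_of_conditionalSelection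
    (hCSP : ∀ (n : ℕ) (w : Sym2 (Fin n) → unitInterval) (S V : Finset (Fin n)) (o : Fin n)
      (𝒯 : Finset (Fin n) → Prop) (ρ : Fin n → ℕ), S ⊆ V → o ∉ V → (∀ T T' : Finset (Fin n), T ⊆ T' → 𝒯 T → 𝒯 T') →
      Set.InjOn ρ ↑S →
      (∀ b ∈ S, ∀ c ∈ S, ρ c < ρ b →
        (prodBernoulli w).real {ω : BondConfig (Fin n) | 𝒯 (V.filter fun x => ω ∈ openConn c x)} ≤
          (prodBernoulli w).real {ω : BondConfig (Fin n) | 𝒯 (V.filter fun x => ω ∈ openConn b x)}) →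
      ∑ c ∈ S, (prodBernoulli w).real
          ((openConn o c ∩ {ω : BondConfig (Fin n) | ∀ c' ∈ S, ρ c' < ρ c → ω ∉ openConn o c'}) ∩
            {ω : BondConfig (Fin n) | ¬ 𝒯 (V.filter fun x => ω ∈ openConn c x)}) /
        (prodBernoulli w).real {ω : BondConfig (Fin n) | ¬ 𝒯 (V.filter fun x => ω ∈ openConn c x)} ≤
      1 * (prodBernoulli w).real (⋃ c ∈ S, (openConn o c : Set (BondConfig (Fin n))))) :
    Literature.StrongHypotheses.CriticalPhenomena.KozmaNitzan2024_conjecture1 := by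
  intro n w A o b t ht
  set μ := prodBernoulli w with hμ
  -- degenerate cases: `t ≤ 0`, `o ∈ A`, `o = b`
  by_cases ht0 : t ≤ 0
  · exact le_trans (mul_nonpos_of_nonneg_of_nonpos measureReal_nonneg ht0) measureReal_nonneg
  have htpos : 0 < t := lt_of_not_ge ht0
  have hU1 : μ.real (⋃ a ∈ A, (openConn o a : Set (BondConfig (Fin n)))) ≤ 1 := measureReal_le_one
  by_cases hoA : o ∈ A
  · calc μ.real (⋃ a ∈ A, (openConn o a : Set (BondConfig (Fin n)))) * t ≤ 1 * t :=
          mul_le_mul_of_nonneg_right hU1 htpos.le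
      _ ≤ μ.real (openConn o b) := by rw [one_mul]; exact ht o hoA
  by_cases hob : o = b
  · subst hob
    have h1 : μ.real (openConn o o : Set (BondConfig (Fin n))) = 1 := by
      have : (openConn o o : Set (BondConfig (Fin n))) = univ :=
        Set.eq_univ_of_forall fun ω => (SimpleGraph.Reachable.refl o : (openGraph ω).Reachable o o)
      rw [this, probReal_univ]
    rw [h1]
    by_cases hA : A.Nonempty
    · obtain ⟨a, ha⟩ := hA
      calc μ.real (⋃ a ∈ A, (openConn o a : Set (BondConfig (Fin n)))) * t ≤ 1 * t :=
            mul_le_mul_of_nonneg_right hU1 htpos.le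
        _ ≤ 1 := by rw [one_mul]; exact (ht a ha).trans measureReal_le_one
    · rw [Finset.not_nonempty_iff_eq_empty.1 hA]
      simp
  -- `A = ∅` is trivial
  by_cases hA : A.Nonempty
  swap
  · rw [Finset.not_nonempty_iff_eq_empty.1 hA]
    simp
  have ht1 : t ≤ 1 := by
    obtain ⟨a, ha⟩ := hA
    exact (ht a ha).trans measureReal_le_one
  -- main case: the principle with `S = A`, `V = insert b A`, target `b ∈ T`
  set V := insert b A with hV
  have hoV : o ∉ V := by
    rw [hV, Finset.mem_insert]; push Not; exact ⟨hob, hoA⟩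
  set p : Fin n → ℝ := fun c => μ.real (openConn c b : Set (BondConfig (Fin n))) with hp
  obtain ⟨ρ, hρ, hmono⟩ := CoinReduction.exists_compatible_ranking (fun c => - p c) A
  have htarget : ∀ c ∈ A, {ω : BondConfig (Fin n) | b ∈ V.filter fun x => ω ∈ openConn c x} = openConn c b := by
    intro c _
    ext ω
    simp only [mem_setOf_eq, Finset.mem_filter, hV, Finset.mem_insert, true_or, true_and]
  have hntarget : ∀ c ∈ A,
      {ω : BondConfig (Fin n) | ¬ b ∈ V.filter fun x => ω ∈ openConn c x} = (openConn c b)ᶜ := by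
    intro c hc
    rw [← htarget c hc]
    rfl
  have hCSPA := hCSP n w A V o (fun T => b ∈ T) ρ (by rw [hV]; exact Finset.subset_insert b A) hoV
    (fun T T' hTT' hT => hTT' hT) hρ
    (by
      intro x hx c hc hlt
      rw [htarget c hc, htarget x hx]
      have := hmono c hc x hx hlt
      simp only [neg_le_neg_iff] at this
      exact this)
  set E : Fin n → Set (BondConfig (Fin n)) := fun c =>
    openConn o c ∩ {ω : BondConfig (Fin n) | ∀ c' ∈ A, ρ c' < ρ c → ω ∉ openConn o c'} with hE
  have hL : ∑ c ∈ A, μ.real (E c ∩ {ω : BondConfig (Fin n) | ¬ b ∈ V.filter fun x => ω ∈ openConn c x}) /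
        μ.real {ω : BondConfig (Fin n) | ¬ b ∈ V.filter fun x => ω ∈ openConn c x} =
      ∑ c ∈ A, μ.real (E c ∩ (openConn c b)ᶜ) / μ.real ((openConn c b : Set (BondConfig (Fin n)))ᶜ) :=
    Finset.sum_congr rfl fun c hc => by rw [hntarget c hc]
  change ∑ c ∈ A, μ.real (E c ∩ {ω : BondConfig (Fin n) | ¬ b ∈ V.filter fun x => ω ∈ openConn c x}) /
      μ.real {ω : BondConfig (Fin n) | ¬ b ∈ V.filter fun x => ω ∈ openConn c x} ≤
    1 * μ.real (⋃ c ∈ A, (openConn o c : Set (BondConfig (Fin n)))) at hCSPA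
  rw [hL, one_mul] at hCSPA
  -- `Σ_c μ(E_c) = μ(o ↔ A)`, `Σ_c μ(E_c ∩ {c ↔ b}) ≤ μ(o ↔ b)`, `μ(E_c) = μ(E_c ∩ {c ↔ b}) + μ(E_c ∩ {c ↮ b})`
  have hsumE := SelectionOrder.sum_real_first_eq μ A o ρ hρ
  have hdisj : (↑A : Set (Fin n)).PairwiseDisjoint fun c => E c ∩ openConn c b := by
    intro c hc c' hc' hne
    simp only [Function.onFun]
    refine Set.disjoint_left.2 fun ω hω hω' => ?_
    obtain ⟨⟨hoc, hmin⟩, _⟩ := hω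
    obtain ⟨⟨hoc', hmin'⟩, _⟩ := hω'
    have hne' : ρ c ≠ ρ c' := fun h => hne (hρ hc hc' h)
    rcases lt_or_gt_of_ne hne' with h | h
    · exact hmin' c (Finset.mem_coe.1 hc) h hoc
    · exact hmin c' (Finset.mem_coe.1 hc') h hoc'
  have hsumB : ∑ c ∈ A, μ.real (E c ∩ openConn c b) ≤ μ.real (openConn o b : Set (BondConfig (Fin n))) := by
    rw [← measureReal_biUnion_finset hdisj (fun c _ => MeasurableSet.of_discrete)]
    refine measureReal_mono (Set.iUnion₂_subset fun c _ => ?_)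
    rintro ω ⟨⟨hoc, _⟩, hcb⟩
    exact (hoc : (openGraph ω).Reachable o c).trans hcb
  have hsplit : ∀ c, μ.real (E c) = μ.real (E c ∩ openConn c b) + μ.real (E c ∩ (openConn c b)ᶜ) := by
    intro c
    rw [← measureReal_inter_add_sdiff (s := E c)
      (MeasurableSet.of_discrete : MeasurableSet (openConn c b : Set (BondConfig (Fin n)))), Set.sdiff_eq]
  -- termwise: `μ(E_c ∩ {c ↮ b}) ≤ (1 - t) · (μ(E_c ∩ {c ↮ b}) / μ{c ↮ b})`
  have hcompl_real : ∀ c, μ.real ((openConn c b : Set (BondConfig (Fin n)))ᶜ) = 1 - p c := fun c =>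
    probReal_compl_eq_one_sub MeasurableSet.of_discrete
  have hterm : ∀ c ∈ A, μ.real (E c ∩ (openConn c b)ᶜ) ≤
      (1 - t) * (μ.real (E c ∩ (openConn c b)ᶜ) / μ.real ((openConn c b : Set (BondConfig (Fin n)))ᶜ)) := by
    intro c hc
    have hle : μ.real (E c ∩ (openConn c b)ᶜ) ≤ μ.real ((openConn c b : Set (BondConfig (Fin n)))ᶜ) :=
      measureReal_mono inter_subset_right
    have hnn : 0 ≤ μ.real (E c ∩ (openConn c b)ᶜ) := measureReal_nonneg
    have hq : μ.real ((openConn c b : Set (BondConfig (Fin n)))ᶜ) ≤ 1 - t := by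
      rw [hcompl_real c]; linarith [ht c hc]
    by_cases hz : μ.real ((openConn c b : Set (BondConfig (Fin n)))ᶜ) = 0
    · rw [hz, div_zero, mul_zero]
      linarith
    · have hpos : 0 < μ.real ((openConn c b : Set (BondConfig (Fin n)))ᶜ) :=
        lt_of_le_of_ne measureReal_nonneg (Ne.symm hz)
      calc μ.real (E c ∩ (openConn c b)ᶜ)
          = μ.real ((openConn c b : Set (BondConfig (Fin n)))ᶜ) *
              (μ.real (E c ∩ (openConn c b)ᶜ) / μ.real ((openConn c b : Set (BondConfig (Fin n)))ᶜ)) := by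
            field_simp
        _ ≤ (1 - t) * (μ.real (E c ∩ (openConn c b)ᶜ) / μ.real ((openConn c b : Set (BondConfig (Fin n)))ᶜ)) :=
            mul_le_mul_of_nonneg_right hq (div_nonneg hnn hpos.le)
  have hmiss : ∑ c ∈ A, μ.real (E c ∩ (openConn c b)ᶜ) ≤
      (1 - t) * μ.real (⋃ c ∈ A, (openConn o c : Set (BondConfig (Fin n)))) := by
    calc ∑ c ∈ A, μ.real (E c ∩ (openConn c b)ᶜ)
        ≤ ∑ c ∈ A, (1 - t) * (μ.real (E c ∩ (openConn c b)ᶜ) / μ.real ((openConn c b : Set (BondConfig (Fin n)))ᶜ)) :=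
          Finset.sum_le_sum hterm
      _ = (1 - t) * ∑ c ∈ A, μ.real (E c ∩ (openConn c b)ᶜ) / μ.real ((openConn c b : Set (BondConfig (Fin n)))ᶜ) := by
          rw [Finset.mul_sum]
      _ ≤ (1 - t) * μ.real (⋃ c ∈ A, (openConn o c : Set (BondConfig (Fin n)))) :=
          mul_le_mul_of_nonneg_left hCSPA (by linarith)
  have hsumsplit : ∑ c ∈ A, μ.real (E c) =
      ∑ c ∈ A, μ.real (E c ∩ openConn c b) + ∑ c ∈ A, μ.real (E c ∩ (openConn c b)ᶜ) := by
    rw [← Finset.sum_add_distrib]; exact Finset.sum_congr rfl fun c _ => hsplit c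
  rw [hsumE] at hsumsplit
  nlinarith [hsumsplit, hsumB, hmiss, measureReal_nonneg (μ := μ) (s := ⋃ c ∈ A, (openConn o c : Set (BondConfig (Fin n))))]

end ConditionalSelection

end Summit.CriticalPhenomena.PercolationContinuityZ3.Theorems

end
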